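import Summits.BirchSwinnertonDyer.BirchSwinnertonDyer.Theorems.KimAtThreeDeepLowerKatoStratumOfFacts
import Summits.BirchSwinnertonDyer.BirchSwinnertonDyer.Theorems.KimAtThreeKolyvaginIsogenyCruxes
import Literature.NumberTheory.EllipticCurves.SelmerCorankControlRatProofs
import HarnessLib

/-!
# Route `KimAtThreeKolyvagin` (rung W2), crux `DeepLowerAtThree` (item 19075): the §L SPLIT GLUE —
# the crux BY NAME from the §U shared parts and ONE off-stratum complement (no stub child needed)

Cell `bsd-addord`, seat `bsd-addord-w2-c2` (gen 3; D-0074 row B5). TOOL FILE for the planner's deferred §L split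
(`HOME/planner/SPLIT-DRAFTS-W2-g15.md` §L: "revisit when §U lands" — §U/§S landed at route rev 4–6,
2026-08-26T10:52Z). Theorems only (no definition, no named fact, no `sorry`); closes nothing by itself (the
complement hypothesis is crux-sized and the port is item 19560); books nothing. HONEST FRAMING: BSD is not
proved by any of this; crux 19075 stays OPEN; this file says exactly which ITEMS it reduces to.

## What

The 19075 twin of the landed §U glue (`KimAtThreeDeepUpperSplitGlue`, item 19563) and §S glue
(`KimAtThreeShallowEqDeepSplitGlue`, item 19600), with ONE INPUT FEWER: the LOWER half on the Kato stratum is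
w2-c2 g0's `KimAtThreeDeepLowerKatoStratumOfFacts.deepLower_optimal_of_ports_of_poitouTate` (kim3 g8's
GRANTED-ports rung over the Poitou–Tate fact), whose inputs are {[S24] Thm 4.4 (1)(2), GZK, Poitou–Tate, the
shared-generator PORT″ at `t = 0`} — it does NOT consume the stub-at-the-empty-level port (item 19561), which
only the UPPER half needs. Hence:

* `deepLowerAtThree_of_parts` — `DeepLowerAtThree` ⟸ the four PUBLISHED leaves BY NAME (route decls
  `SakamotoKolyvaginThree` 19558, `RankEqAnalyticRankLeOne` 19921, `PoitouTateSelmerDuality` 19559,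
  `CarayolLevelEqConductor` 19467) → the PORT item `KatoKuriharaPortThreeShared` (19560) BY NAME → the
  complement `DeepLowerAtThreeOffKatoStratum` (spelled inline VERBATIM in the shape of the landed complement
  cruxes 19562 / 19599: the parent in kim3's optimal-datum-at-conductor currency restricted to the rows NOT on
  the Kato stratum `Addv W₀ 3 ∧ 3 ∤ c₃ ∧ #E(ℚ₃)[3] = 1 ∧ 3 ∤ c_{D₀}`);
* `deepLowerAtThree_of_sharedParts` — the same from the alias conjunction `DeepUpperSplitSharedParts` (item
  19598, its stub conjunct unused) → complement → `DeepLowerAtThree`: the k = 2 glue shape of §S v2, so a §L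
  split `DeepLowerOfParts := DeepUpperSplitSharedParts → DeepLowerAtThreeOffKatoStratum → DeepLowerAtThree`
  closes by `fun h hOff => deepLowerAtThree_of_sharedParts h hOff`.

NET LEDGER READING for 19075 (additive tower rows, `t = 0`, `3 ∤ c₃`, `3 ∤ c_{D₀}`): the residue is EXACTLY
item 19560 (PORT″) + the four PUB leaves; everything else is the off-stratum complement (good / multiplicative
3 with the tower onto, IV/IV* = `3 ∣ c₃`, `E(ℚ₃)[3] ≠ 0`, `3 ∣` Manin constant of the optimal curve), on which
w2-c2 g2's cross-route sockets (`KimAtThreeDeepLowerNonAdditiveRows`, `…OfAdditiveBranch`: K1 leaf / YZ26 /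
Skinner16 by name + Tamagawa divisibility of deep Kurihara numbers) are the by-name discharges of sub-strata.

## Proof

Reduce to lattice-optimal, degree-minimal data at the conductor (kim3 g9
`KimAtThreeKolyvaginIsogenyCruxes.deepLowerAtThree_of_forall_optimalDatum_atConductor`, Carayol); `by_cases` on
the stratum predicate; ON it: the place `v₃ ∣ 3` (`Rat.HeightOneSpectrum.primesEquiv`) and one generator
family `η` (`IsCyclic.exists_generator`, `FSComp.prime_absNorm_rat`) are CONSTRUCTED, the port item is
instantiated at them, and `deepLower_optimal_of_ports_of_poitouTate` concludes; OFF it: the complement verbatim.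

References: [Sakamoto2024] Thm. 4.4; [MazurRubin2004] Thm. 5.2.12; [Kim2022StructureSelmer] Thm. 3.13, Thm.
1.9 (6); [Kim2025RefinedTNC] Thm. 1.1; [Carayol1986]; [MilneADT2006] I Thm. 4.10; planner memo
`HOME/planner/SPLIT-DRAFTS-W2-g15.md` §L/§U/§S.
-/

-- the Theorems namespace of a single-conjunct summit repeats the summit name by design (D-0017)
set_option linter.dupNamespace false

noncomputable section

namespace Summit.BirchSwinnertonDyer.BirchSwinnertonDyer.Theorems.KimAtThreeDeepLowerSplitGlue

open scoped Classical NumberField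
open Function IsDedekindDomain NumberField WeierstrassCurve
  Literature.NumberTheory.EllipticCurves Literature.NumberTheory.EllipticCurves.ModularForms
  Literature.NumberTheory.EllipticCurves.Rank1Residual
  Literature.NumberTheory.GaloisCohomology
  Summit.BirchSwinnertonDyer.Rank1Residual.GaloisImage
  Summit.BirchSwinnertonDyer.BirchSwinnertonDyer.Theses.KimAtThreeKolyvagin
  Summit.BirchSwinnertonDyer.BirchSwinnertonDyer.Theorems
  Summit.BirchSwinnertonDyer.BirchSwinnertonDyer.Theorems.KimAtThreeDeepLowerKatoStratumOfFacts
  Summit.BirchSwinnertonDyer.BirchSwinnertonDyer.Theorems.KimAtThreeKolyvaginIsogenyCruxes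

/-- **`DeepLowerAtThree` ⟸ four PUBLISHED leaves + the PORT item + the off-stratum complement** (no stub):
`SakamotoKolyvaginThree → RankEqAnalyticRankLeOne → PoitouTateSelmerDuality → CarayolLevelEqConductor →
KatoKuriharaPortThreeShared → [complement, inline] → DeepLowerAtThree`. The complement is the parent in kim3's
optimal-datum-at-conductor currency on the rows NOT (additive at 3 ∧ 3 ∤ c₃ ∧ E(ℚ₃)[3] = 0 ∧ 3 ∤ c_{D₀}) — the
exact 19075 twin of item 19562's text. ON the stratum the lower half is
`deepLower_optimal_of_ports_of_poitouTate` at a constructed place `v₃ ∣ 3` and generator family `η`.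
[cite: Kim2025RefinedTNC, Thm. 1.1] [cite: Sakamoto2024, Thm. 4.4 (p. 926)] [cite: MazurRubin2004, Thm. 5.2.12]
[cite: Carayol1986] [cite: MilneADT2006, Ch. I, Thm. 4.10] -/
theorem deepLowerAtThree_of_parts (hSak : SakamotoKolyvaginThree) (hGZK : RankEqAnalyticRankLeOne)
    (hPT : PoitouTateSelmerDuality) (hlev : CarayolLevelEqConductor) (hPort : KatoKuriharaPortThreeShared)
    (hOff : ∀ (W₀ : WeierstrassCurve ℚ) [W₀.IsElliptic] [W₀.IsGloballyMinimal],
      (∀ n : ℕ, W₀.HasSurjectiveModNGaloisRep (3 ^ n : ℕ)) → Finite W₀.sha →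
      ∀ {N : ℕ} [NeZero N], N = W₀.conductorNorm ℤ → ∀ (D₀ : ModularParametrizationData W₀ N),
        (∀ z ∈ D₀.L.lattice, ∃ w ∈ periodLattice D₀.f, z = D₀.c * w) →
        (∀ (W₂ : WeierstrassCurve ℚ) [W₂.IsElliptic] (D₂ : ModularParametrizationData W₂ N),
          D₂.f = D₀.f → D₀.modularDegree ≤ D₂.modularDegree) →
        (∀ r : ℚ, ratPlusSymbol D₀.f r ≠ 0 → 0 ≤ padicValRat 3 (ratPlusSymbol D₀.f r)) →
        kuriharaVanishingOrder W₀ 3 D₀.f = 0 →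
        ¬ ((haveI : Fact (Nat.Prime 3) := ⟨Nat.prime_three⟩; Addv W₀ 3) ∧
            ¬ 3 ∣ (W₀.baseChange ℚ_[3]).localTamagawaNumber ℤ_[3] ∧
            Nat.card {Q : (W₀.baseChange ℚ_[3]).toAffine.Point // (3 : ℕ) • Q = 0} = 1 ∧
            ¬ (3 : ℤ) ∣ D₀.maninConstant) →
        ∃ d : ℕ, kuriharaPartialDeepInfty W₀ 3 D₀.f = d ∧ kuriharaPartial W₀ 3 D₀.f 0 ≤
          ((padicValNat 3 (Nat.card (AddCommGroup.primaryComponent W₀.sha 3)) + d : ℕ) : ℕ∞)) :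
    DeepLowerAtThree := by
  refine deepLowerAtThree_of_forall_optimalDatum_atConductor hlev ?_
  intro W₀ _ _ htow hfin N _ hN D₀ hopt hdeg hint hord
  by_cases hroad :
      ((haveI : Fact (Nat.Prime 3) := ⟨Nat.prime_three⟩; Addv W₀ 3) ∧
        ¬ 3 ∣ (W₀.baseChange ℚ_[3]).localTamagawaNumber ℤ_[3] ∧
        Nat.card {Q : (W₀.baseChange ℚ_[3]).toAffine.Point // (3 : ℕ) • Q = 0} = 1 ∧
        ¬ (3 : ℤ) ∣ D₀.maninConstant)
  · obtain ⟨hadd, hc3, ht0, hcD⟩ := hroad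
    -- the place above 3
    let v₃ : HeightOneSpectrum (𝓞 ℚ) := (Rat.HeightOneSpectrum.primesEquiv (R := 𝓞 ℚ)).symm ⟨3, Nat.prime_three⟩
    have hgen3 : Rat.HeightOneSpectrum.natGenerator v₃ = 3 :=
      congrArg Subtype.val ((Rat.HeightOneSpectrum.primesEquiv (R := 𝓞 ℚ)).apply_symm_apply ⟨3, Nat.prime_three⟩)
    have hv₃ : ((3 : ℕ) : 𝓞 ℚ) ∈ v₃.asIdeal := by
      have h := Rat.HeightOneSpectrum.natCast_natGenerator_mem v₃
      rwa [hgen3] at h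
    -- one generator family η
    have hgen : ∀ q : HeightOneSpectrum (𝓞 ℚ), ∃ η : (ZMod (Ideal.absNorm q.asIdeal))ˣ,
        Subgroup.zpowers η = ⊤ := fun q => by
      haveI : Fact (Ideal.absNorm q.asIdeal).Prime := ⟨FSComp.prime_absNorm_rat q⟩
      obtain ⟨g, hg⟩ := IsCyclic.exists_generator (α := (ZMod (Ideal.absNorm q.asIdeal))ˣ)
      exact ⟨g, (Subgroup.eq_top_iff' _).mpr hg⟩
    choose η hη using hgen
    exact deepLower_optimal_of_ports_of_poitouTate hSak.1 hSak.2 hGZK hPT W₀ hadd hc3 htow ht0 hN D₀ hopt hcD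
      v₃ hv₃ η hη (hPort W₀ htow hadd hc3 ht0 v₃ hv₃ η hη D₀ hN hopt hcD) hord
  · exact hOff W₀ htow hfin hN D₀ hopt hdeg hint hord hroad

/-- **The k = 2 glue shape for a §L split**: `DeepUpperSplitSharedParts` (item 19598 — its six conjuncts by
name; the stub conjunct is NOT used by the lower half) → the off-stratum complement → `DeepLowerAtThree`.
A route decl `DeepLowerOfParts := DeepUpperSplitSharedParts → DeepLowerAtThreeOffKatoStratum → DeepLowerAtThree`
(complement = the `hOff` text) closes by `fun h hOff => deepLowerAtThree_of_sharedParts h hOff`.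
[cite: Kim2025RefinedTNC, Thm. 1.1] [cite: Sakamoto2024, Thm. 4.4 (p. 926)] [cite: MazurRubin2004, Thm. 5.2.12] -/
theorem deepLowerAtThree_of_sharedParts (h : DeepUpperSplitSharedParts)
    (hOff : ∀ (W₀ : WeierstrassCurve ℚ) [W₀.IsElliptic] [W₀.IsGloballyMinimal],
      (∀ n : ℕ, W₀.HasSurjectiveModNGaloisRep (3 ^ n : ℕ)) → Finite W₀.sha →
      ∀ {N : ℕ} [NeZero N], N = W₀.conductorNorm ℤ → ∀ (D₀ : ModularParametrizationData W₀ N),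
        (∀ z ∈ D₀.L.lattice, ∃ w ∈ periodLattice D₀.f, z = D₀.c * w) →
        (∀ (W₂ : WeierstrassCurve ℚ) [W₂.IsElliptic] (D₂ : ModularParametrizationData W₂ N),
          D₂.f = D₀.f → D₀.modularDegree ≤ D₂.modularDegree) →
        (∀ r : ℚ, ratPlusSymbol D₀.f r ≠ 0 → 0 ≤ padicValRat 3 (ratPlusSymbol D₀.f r)) →
        kuriharaVanishingOrder W₀ 3 D₀.f = 0 →
        ¬ ((haveI : Fact (Nat.Prime 3) := ⟨Nat.prime_three⟩; Addv W₀ 3) ∧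
            ¬ 3 ∣ (W₀.baseChange ℚ_[3]).localTamagawaNumber ℤ_[3] ∧
            Nat.card {Q : (W₀.baseChange ℚ_[3]).toAffine.Point // (3 : ℕ) • Q = 0} = 1 ∧
            ¬ (3 : ℤ) ∣ D₀.maninConstant) →
        ∃ d : ℕ, kuriharaPartialDeepInfty W₀ 3 D₀.f = d ∧ kuriharaPartial W₀ 3 D₀.f 0 ≤
          ((padicValNat 3 (Nat.card (AddCommGroup.primaryComponent W₀.sha 3)) + d : ℕ) : ℕ∞)) :
    DeepLowerAtThree := by
  obtain ⟨hSak, hGZK, hPT, hlev, hPort, -⟩ := h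
  exact deepLowerAtThree_of_parts hSak hGZK hPT hlev hPort hOff

end Summit.BirchSwinnertonDyer.BirchSwinnertonDyer.Theorems.KimAtThreeDeepLowerSplitGlue

end
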